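import Literature.NumberTheory.LFunctions.MultiplicativeCorrelations
import HarnessLib

/-!
# Tao's log-averaged Elliott theorem: the §2 reduction to Theorem 2.3

Second layer of the proof DAG of `Literature.NumberTheory.Sieve.tao_log_chowla_liouville` (Tao 2016, Thm 1.2) below
the named fact `Literature.NumberTheory.LFunctions.tao_log_averaged_elliott_two` (Tao 2016, Thm 1.3). In §2 of the paper,
Theorem 1.3 is reduced — via Proposition 2.1 (one may assume `|g₁| = |g₂| = 1`; Halász's
inequality and a random model), Proposition 2.2 (one may assume `g₁, g₂` completely
multiplicative; twisted Möbius inversion), the substitution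
`(a₁, a₂, b₁, b₂) ↦ (a₁a₂, a₁a₂, a₂b₁, a₁b₂)` and the harmless strengthening `ω ≤ x / log x` — to

* `Literature.NumberTheory.LFunctions.Tao2016_theorem23` — NAMED FACT (Tao 2016, Theorem 2.3, "logarithmically averaged
  nonasymptotic Elliott conjecture", reduced form): one linear form `a n + b` and its shift
  `a n + b + h`, `h ≠ 0`, completely multiplicative `S¹`-valued `g₁, g₂`.
* `Literature.NumberTheory.LFunctions.Tao2016_section2_reduction` — NAMED FACT (Tao 2016, §2, before Thm 2.3: "Putting all these
  reductions together, we see that Theorem 1.3 will be a consequence of [Theorem 2.3]"):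
  `Tao2016_theorem23 → tao_log_averaged_elliott_two`.
* `Literature.NumberTheory.LFunctions.tao_log_averaged_elliott_two_of_theorem23` — the (trivial) assembly.

Theorem 2.3 itself is proved in §§3–4 of the paper by contradiction (Prop. 2.4 from
Matomäki–Radziwiłł–Tao 2015; Lemma 2.5 approximate affine invariance; Prop. 2.6; the entropy
decrement argument Lemma 3.2; Lemmas 3.3, 3.5 (Hoeffding), 3.6 (circle method) and a restriction
estimate for prime exponential sums); those internal steps live inside one proof by
contradiction with a hierarchy of parameters `ε, H₋, H₊, A` and are not vendored as standalone
facts here.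

## References
* T. Tao, *The logarithmically averaged Chowla and Elliott conjectures for two-point
  correlations*, Forum Math. Pi 4 (2016), e8; arXiv:1509.05422, §2 (Props 2.1, 2.2, Thm 2.3).

## Design choices
* `g₁, g₂ : ℕ → ℂ`; "completely multiplicative, `S¹`-valued on `ℕ = {1, 2, …}`" is spelled out on
  positive arguments (`g (m n) = g m g n`, `‖g n‖ = 1` for `m, n ≥ 1`); the value at `0` is
  irrelevant: the hypothesis only involves primes (`Literature.NumberTheory.Sieve.pretentiousDistSq`) and, in the
  conclusion, `n > x/ω ≥ log x ≥ log A`, so for `A` large (depending on `b, h`, as the theorem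
  allows) the integer arguments `a n + b`, `a n + b + h` are positive; they are fed to `g` through
  `Int.toNat`.
* `b, h` are integers as printed (`h ≠ 0`); the non-pretentiousness hypothesis (2.2) = (1.6) is
  transcribed exactly as in `Literature.NumberTheory.LFunctions.tao_log_averaged_elliott_two`.
* The printed range "`x ≥ x / log x ≥ ω ≥ A`" is transcribed as `A ≤ ω`, `ω ≤ x / log x`,
  `ω ≤ x`.
-/

open Finset Complex

namespace Literature.NumberTheory.LFunctions

/-- NAMED FACT — **Tao 2016, Theorem 2.3** (logarithmically averaged nonasymptotic Elliott
conjecture, reduced form; Forum Math. Pi 4 (2016) e8, Thm 2.3): "Let `a` be a natural number, and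
let `b, h` be integers with `h ≠ 0`. Let `ε > 0`, and suppose that `A` is sufficiently large
depending on `ε, a, b, h`. Let `x ≥ x / log x ≥ ω ≥ A`, and let `g₁, g₂ : ℕ → S¹` be completely
multiplicative functions such that `∑_{p ≤ x} (1 - Re g₁(p) χ̄(p) p^{-it}) / p ≥ A` holds for all
Dirichlet characters `χ` of period at most `A`, and all real numbers `t` with `|t| ≤ A x`. Then
`|∑_{x/ω < n ≤ x} g₁(a n + b) g₂(a n + b + h) / n| ≤ ε log ω`."
Users take `(h : Tao2016_theorem23)`. [cite: TaoFMP2016, Theorem 2.3] -/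
def Tao2016_theorem23 : Prop :=
  ∀ (a : ℕ) (b h : ℤ), 1 ≤ a → h ≠ 0 → ∀ ε : ℝ, 0 < ε →
    ∃ A₀ : ℝ, ∀ A : ℝ, A₀ ≤ A → ∀ x ω : ℝ, A ≤ ω → ω ≤ x / Real.log x → ω ≤ x →
      ∀ g₁ g₂ : ℕ → ℂ,
        (∀ m n : ℕ, 1 ≤ m → 1 ≤ n → g₁ (m * n) = g₁ m * g₁ n) →
        (∀ m n : ℕ, 1 ≤ m → 1 ≤ n → g₂ (m * n) = g₂ m * g₂ n) →
        (∀ n : ℕ, 1 ≤ n → ‖g₁ n‖ = 1) → (∀ n : ℕ, 1 ≤ n → ‖g₂ n‖ = 1) →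
        (∀ (q : ℕ) (χ : DirichletCharacter ℂ q) (t : ℝ), 1 ≤ q → (q : ℝ) ≤ A → |t| ≤ A * x →
          A ≤ Sieve.pretentiousDistSq g₁ (Sieve.twistedChar χ t) x) →
        ‖∑ n ∈ Ioc ⌊x / ω⌋₊ ⌊x⌋₊,
            g₁ ((a : ℤ) * n + b).toNat * g₂ ((a : ℤ) * n + b + h).toNat / (n : ℂ)‖
          ≤ ε * Real.log ω

/-- NAMED FACT — **Tao 2016, §2: Theorem 2.3 implies Theorem 1.3** (Forum Math. Pi 4 (2016) e8,
§2, Propositions 2.1 and 2.2 and the two reductions following them, concluding, just before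
Theorem 2.3:
"Putting all these reductions together, we see that Theorem 1.3 will be a consequence of the
following theorem" [Theorem 2.3]). The reduction uses Halász's inequality and a random
multiplicative model (Prop. 2.1: one may assume `|g₁(n)| = |g₂(n)| = 1`), twisted Möbius
inversion `g₁ = g̃₁ * h` (Prop. 2.2: one may assume complete multiplicativity), the substitution
`(a₁, a₂, b₁, b₂) ↦ (a₁a₂, a₁a₂, a₂b₁, a₁b₂)`, and the observation that `ω ≤ x` may be
strengthened to `ω ≤ x / log x`. Users take `(h : Tao2016_section2_reduction)`.
[cite: TaoFMP2016, §2 (Propositions 2.1, 2.2 and the paragraph before Theorem 2.3)] -/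
def Tao2016_section2_reduction : Prop :=
  Tao2016_theorem23 → tao_log_averaged_elliott_two

/-- **Assembly of §2** (Tao 2016): Theorem 2.3 and the §2 reduction give Theorem 1.3
(`Literature.NumberTheory.LFunctions.tao_log_averaged_elliott_two`). [cite: TaoFMP2016, §2 (paragraph before Theorem 2.3)] -/
theorem tao_log_averaged_elliott_two_of_theorem23 (hred : Tao2016_section2_reduction)
    (h23 : Tao2016_theorem23) : tao_log_averaged_elliott_two :=
  hred h23

end Literature.NumberTheory.LFunctions
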